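import Summits.AtomisticToContinuum.HydrodynamicLimit.Theorems.StiffCollisionalRelaxationAprioriBoundsFibreDefsR4
import Summits.AtomisticToContinuum.HydrodynamicLimit.Theorems.BoltzmannGreenKubo.Negative.Stationarity
import Summits.AtomisticToContinuum.HydrodynamicLimit.Theorems.CollisionIsometryCLTCollisionalTransferLocalityGibbsTranslation
import HarnessLib

/-!
# Equilibrium instance of the in-mean floor of the kernel block density
(line `meso-chebyshev-window`, crux `StiffCollisionalRelaxation.AprioriBounds`, stmt-AtomisticToContinuum-14827)

Helper file (`--supports stmt-AtomisticToContinuum-14827`), EQUILIBRIUM UNIT TEST of the registered stub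
`stub_meanFloor` (stub 1 of `Cruxes/AprioriBounds/Lines/meso_chebyshev_window.lean`, OPEN IN KIND).

Stub 1 asks, under the crux prefix, for `∃ m > 0 ∃ N₀ ∀ N ≥ N₀ ∀ s ∈ [0,t] ∀ x, m ≤ E_{P_N} ρ̄_φ(s,x)`, the mean
being the Bochner integral of the kernel block density
`ρ̄_φ(s,x)(z) = empiricalDensityField ((Φ N).flow s z) (fun y => φ N (y - x)) = (N+1)⁻¹ ∑ᵢ φ_N(qᵢ(s) − x)`
against the local Gibbs law `P_N = localGibbsLaw σ a₀ u₀ θ₀ N (Φ N)`.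

On the EQUILIBRIUM RUNG (constant profiles `a₀ ≡ a`, `u₀ ≡ uc`, `θ₀ ≡ θc`) the mean is computed EXACTLY, for
every flow family, every time, every block centre and every `N`:

  `E_{G_N} ρ̄_φ(s, x) = ∫ φ`        (`integral_blockDensity_flow_localGibbsLaw_const`),

whenever `G_N` is a probability law (`σ ≤ 1/2`) and `φ` is continuous.  Three invariances, all landed:
(1) FLOW INVARIANCE of the homogeneous law, `(Φ_s)_# G_N = G_N` (`BoltzmannGreenKuboOrthMomentum.map_flow_localGibbsLaw_const`,
= support item `HomogeneousInvariance`, stmt-9621), removes the time; (2) TRANSLATION INVARIANCE of the homogeneous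
law under the diagonal shift of all positions (`HemisphereAffineSlaving.map_translate_localGibbsLaw_const`) together
with `ρ̄(T_y z, x) = ρ̄(z, x − y)` makes `x ↦ E ρ̄(·, x)` constant; (3) the AVERAGING IDENTITY
`∫ₓ ρ̄(z, x) dx = ∫ φ` for every configuration (`AprioriBoundsNegative.integral_blockDensity`, Haar invariance on
`𝕋³`) and Fubini (`integral_integral_swap`; the integrand is continuous and bounded on a finite product measure)
identify the constant as `∫ φ`.  Hence stub 1 HOLDS on the equilibrium rung with `m = 1`, `N₀ = 0`
(`meanFloor_equilibrium`: the statement of stub 1 with the profile quantifiers specialised to positive constants,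
`σ₀ := 1/2`, `η₁ := 1`; the Euler solution, the `t = 0` LLN and the chamber are not used).

No new definitions, no named facts; axioms `propext`, `Classical.choice`, `Quot.sound`.
-/

noncomputable section

open MeasureTheory ProbabilityTheory Filter Set Topology
open scoped ENNReal

namespace Summit.AtomisticToContinuum.HydrodynamicLimit.Theorems.MesoChebyshevWindow

open Literature.MathematicalPhysics.KineticTheory Literature.Analysis.FluidPDE
open Summit.AtomisticToContinuum.HydrodynamicLimit.Theorems.AprioriBoundsNegative (PartOneAt PartTwoAt)
open Summit.AtomisticToContinuum.HydrodynamicLimit.Theorems.VisitLedgerUpscattering (Cfg Flow Flows NiceProfiles)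
open Summit.AtomisticToContinuum.HydrodynamicLimit.Theorems.FibreDeficitTransfer

/-! ## The block density `(x, z) ↦ ρ̄(z, x)`: continuity, boundedness -/

/-- The kernel block density `ρ̄(z, x) = (N+1)⁻¹ ∑ᵢ φ(xᵢ − x)` is jointly continuous in the block centre and
the configuration, for a continuous kernel. [folklore] -/
theorem continuous_blockDensity_uncurry {N : ℕ} {φ : T3 → ℝ} (hφ : Continuous φ) :
    Continuous (Function.uncurry fun (x : T3) (z : Config (N + 1) (Fin 3) T3) =>
      empiricalDensityField z (fun w => φ (w - x))) := by
  have h : (Function.uncurry fun (x : T3) (z : Config (N + 1) (Fin 3) T3) =>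
      empiricalDensityField z (fun w => φ (w - x))) =
      fun p => ((N + 1 : ℕ) : ℝ)⁻¹ * ∑ i, φ ((p.2 i).1 - p.1) := by
    funext ⟨x, z⟩
    simp only [Function.uncurry_apply_pair, AprioriBoundsNegative.blockDensity_eq]
  rw [h]
  exact continuous_const.mul (continuous_finsetSum _ fun i _ =>
    hφ.comp ((((continuous_apply i).comp continuous_snd).fst).sub continuous_fst))

/-- The kernel block density `z ↦ ρ̄(z, x)` is measurable in the configuration. [folklore] -/
theorem measurable_blockDensity_cfg {N : ℕ} {φ : T3 → ℝ} (hφ : Continuous φ) (x : T3) :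
    Measurable fun z : Config (N + 1) (Fin 3) T3 => empiricalDensityField z (fun w => φ (w - x)) :=
  ((continuous_blockDensity_uncurry hφ).comp (Continuous.prodMk_right x)).measurable

/-- `|ρ̄(z, x)| ≤ K` when `|φ| ≤ K`. [folklore] -/
theorem abs_blockDensity_le {N : ℕ} {φ : T3 → ℝ} {K : ℝ} (hK : ∀ y, |φ y| ≤ K)
    (z : Config (N + 1) (Fin 3) T3) (x : T3) :
    |empiricalDensityField z (fun w => φ (w - x))| ≤ K := by
  rw [AprioriBoundsNegative.blockDensity_eq, abs_mul, abs_of_nonneg (by positivity)]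
  calc ((N + 1 : ℕ) : ℝ)⁻¹ * |∑ i, φ ((z i).1 - x)|
      ≤ ((N + 1 : ℕ) : ℝ)⁻¹ * ∑ _i : Fin (N + 1), K :=
        mul_le_mul_of_nonneg_left ((Finset.abs_sum_le_sum_abs _ _).trans
          (Finset.sum_le_sum fun i _ => hK _)) (by positivity)
    _ = K := by
        rw [Finset.sum_const, Finset.card_univ, Fintype.card_fin, nsmul_eq_mul, ← mul_assoc,
          inv_mul_cancel₀ (by positivity), one_mul]

/-- The translated configuration sees the block centre shifted back: `ρ̄(T_y z, x) = ρ̄(z, x − y)`.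
[folklore] -/
theorem blockDensity_translate {N : ℕ} (φ : T3 → ℝ) (y : T3) (z : Config (N + 1) (Fin 3) T3) (x : T3) :
    empiricalDensityField (N := N + 1) (fun i => ((z i).1 + y, (z i).2)) (fun w => φ (w - x)) =
      empiricalDensityField z (fun w => φ (w - (x - y))) := by
  rw [AprioriBoundsNegative.blockDensity_eq, AprioriBoundsNegative.blockDensity_eq]
  simp only [sub_sub_eq_add_sub]

/-! ## The mean block density under the homogeneous law -/

section Homogeneous

variable {σ : ℝ} (a θc : ℝ) (uc : V3)

/-- **Flow invariance removes the time.**  Under the constant-profile local Gibbs law, the mean kernel block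
density along ANY hard-sphere flow at time `s` equals the mean at time `0`'s configuration:
`E_{G_N} ρ̄(Φ_s ·, x) = E_{G_N} ρ̄(·, x)` (`(Φ_s)_# G_N = G_N`, `map_flow_localGibbsLaw_const`). [folklore] -/
theorem integral_blockDensity_flow_const {N : ℕ}
    (Φ : HardSphereFlow (Torus.geometry (Fin 3)) (hsDiameter σ N) (N + 1)) {φ : T3 → ℝ}
    (hφ : Continuous φ) (s : ℝ) (x : T3) :
    ∫ z, empiricalDensityField (Φ.flow s z) (fun w => φ (w - x))
        ∂(localGibbsLaw σ (fun _ => a) (fun _ => uc) (fun _ => θc) N Φ) =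
      ∫ z, empiricalDensityField z (fun w => φ (w - x))
        ∂(localGibbsLaw σ (fun _ => a) (fun _ => uc) (fun _ => θc) N Φ) := by
  rw [← integral_map (Φ.measurable_flow s).aemeasurable
      (measurable_blockDensity_cfg hφ x).aestronglyMeasurable,
    BoltzmannGreenKuboOrthMomentum.map_flow_localGibbsLaw_const a θc uc Φ s]

/-- **Translation invariance removes the block centre.**  Under the constant-profile local Gibbs law the mean
kernel block density does not depend on the block centre: `E_{G_N} ρ̄(·, x) = E_{G_N} ρ̄(·, 0)` (diagonal
shift by `−x`, `map_translate_localGibbsLaw_const`, `blockDensity_translate`). [folklore] -/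
theorem integral_blockDensity_const_centre {N : ℕ}
    (Φ : (N : ℕ) → HardSphereFlow (Torus.geometry (Fin 3)) (hsDiameter σ N) (N + 1)) {φ : T3 → ℝ}
    (hφ : Continuous φ) (x : T3) :
    ∫ z, empiricalDensityField z (fun w => φ (w - x))
        ∂(localGibbsLaw σ (fun _ => a) (fun _ => uc) (fun _ => θc) N (Φ N)) =
      ∫ z, empiricalDensityField z (fun w => φ (w - 0))
        ∂(localGibbsLaw σ (fun _ => a) (fun _ => uc) (fun _ => θc) N (Φ N)) := by
  set G := localGibbsLaw σ (fun _ => a) (fun _ => uc) (fun _ => θc) N (Φ N) with hG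
  have hT : Measurable (fun z : Config (N + 1) (Fin 3) T3 =>
      (fun i => ((z i).1 + -x, (z i).2) : Config (N + 1) (Fin 3) T3)) :=
    (HemisphereAffineSlaving.measurePreserving_translate N (-x)).measurable
  have hmap : Measure.map (fun z : Config (N + 1) (Fin 3) T3 =>
      (fun i => ((z i).1 + -x, (z i).2) : Config (N + 1) (Fin 3) T3)) G = G :=
    HemisphereAffineSlaving.map_translate_localGibbsLaw_const a θc uc Φ N (-x)
  have hpt : ∀ z : Config (N + 1) (Fin 3) T3, empiricalDensityField z (fun w => φ (w - x)) =
      empiricalDensityField (N := N + 1) (fun i => ((z i).1 + -x, (z i).2)) (fun w => φ (w - 0)) := by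
    intro z
    rw [blockDensity_translate, zero_sub, neg_neg]
  rw [integral_congr_ae (Eventually.of_forall hpt),
    ← integral_map hT.aemeasurable (measurable_blockDensity_cfg hφ 0).aestronglyMeasurable, hmap]

/-- **The mean kernel block density under the homogeneous law is the mass of the kernel**, for every
hard-sphere flow family, every time `s`, every block centre `x` and every `N`:
`E_{G_N} ρ̄_φ(s, x) = ∫ φ` (probability law `G_N`, continuous `φ`).  Flow invariance + translation invariance +
the averaging identity `∫ₓ ρ̄(z, x) dx = ∫ φ` + Fubini. [folklore] -/
theorem integral_blockDensity_flow_localGibbsLaw_const {N : ℕ}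
    (Φ : (N : ℕ) → HardSphereFlow (Torus.geometry (Fin 3)) (hsDiameter σ N) (N + 1))
    [IsProbabilityMeasure (localGibbsLaw σ (fun _ => a) (fun _ => uc) (fun _ => θc) N (Φ N))]
    {φ : T3 → ℝ} (hφ : Continuous φ) (s : ℝ) (x : T3) :
    ∫ z, empiricalDensityField ((Φ N).flow s z) (fun w => φ (w - x))
        ∂(localGibbsLaw σ (fun _ => a) (fun _ => uc) (fun _ => θc) N (Φ N)) = ∫ y, φ y := by
  set G := localGibbsLaw σ (fun _ => a) (fun _ => uc) (fun _ => θc) N (Φ N) with hG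
  rw [integral_blockDensity_flow_const a θc uc (Φ N) hφ s x,
    integral_blockDensity_const_centre a θc uc Φ hφ x]
  -- Fubini for the bounded continuous integrand `(x, z) ↦ ρ̄(z, x)` on `volume × G`
  have hint : Integrable (Function.uncurry fun (x : T3) (z : Config (N + 1) (Fin 3) T3) =>
      empiricalDensityField z (fun w => φ (w - x))) ((volume : Measure T3).prod G) := by
    obtain ⟨K, -, hK⟩ := exists_forall_abs_le_of_continuous hφ
    refine Integrable.of_bound (continuous_blockDensity_uncurry hφ).measurable.aestronglyMeasurable K
      (ae_of_all _ fun p => ?_)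
    rcases p with ⟨x', z⟩
    rw [Function.uncurry_apply_pair, Real.norm_eq_abs]
    exact abs_blockDensity_le hK z x'
  have hswap := integral_integral_swap hint
  -- left: the inner mean does not depend on the centre; right: the inner spatial average is `∫ φ`
  have hleft : (fun x' : T3 => ∫ z, empiricalDensityField z (fun w => φ (w - x')) ∂G) =
      fun _ => ∫ z, empiricalDensityField z (fun w => φ (w - 0)) ∂G :=
    funext fun x' => integral_blockDensity_const_centre a θc uc Φ hφ x'
  have hright : (fun z : Config (N + 1) (Fin 3) T3 =>
      ∫ x' : T3, empiricalDensityField z (fun w => φ (w - x'))) = fun _ => ∫ y, φ y :=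
    funext fun z => AprioriBoundsNegative.integral_blockDensity (Nat.succ_ne_zero N) z
      (integrable_of_continuous_T3 hφ)
  simp only [hleft, hright, integral_const, smul_eq_mul, probReal_univ, one_mul] at hswap
  exact hswap

end Homogeneous

/-! ## Stub 1 on the equilibrium rung -/

/-- **Equilibrium unit test of stub 1 (`stub_meanFloor`).**  The statement of stub 1 with the profile
quantifiers `∀ a₀ θ₀ u₀` (continuous, positive) specialised to positive CONSTANTS holds, with `σ₀ := 1/2`,
`η₁ := 1`, `m := 1`, `N₀ := 0`: for `σ ≤ 1/2` the laws are probability measures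
(`isProbabilityMeasure_localGibbsLaw`) and `E_{G_N} ρ̄_φ(s, x) = ∫ φ_N = 1` for every flow family, `s`, `x`,
`N` (`integral_blockDensity_flow_localGibbsLaw_const`; admissible kernels are smooth hence continuous, of unit
mass).  The Euler solution, the `t = 0` law of large numbers and the chamber of the crux prefix are not
used. [folklore] -/
theorem meanFloor_equilibrium : ∀ (a θc : ℝ) (uc : V3), 0 < a → 0 < θc → ∃ σ₀ : ℝ, 0 < σ₀ ∧ ∃ η₁ : ℝ, 0 < η₁ ∧ ∀ σ : ℝ, 0 < σ → σ < σ₀ → ∀ (T : ℝ) (ρ θ : ℝ → T3 → ℝ) (u : ℝ → T3 → V3), IsHardSphereEulerSolution σ T ρ u θ → ∀ Φ : (N : ℕ) → HardSphereFlow (Torus.geometry (Fin 3)) (hsDiameter σ N) (N + 1), TendstoHydroFieldsAt (fun N => localGibbsLaw σ (fun _ => a) (fun _ => uc) (fun _ => θc) N (Φ N)) Φ ρ u θ 0 → ∀ t : ℝ, 0 < t → t < T → (∀ s ∈ Icc 0 t, ∀ x, 2 * ρ s x * σ ^ 3 < η₁) → ∀ (γ C : ℝ) (φ : ℕ → T3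 → ℝ), 0 < γ → γ ≤ 1 / 15 → ((∀ N, Literature.Analysis.FunctionSpaces.Torus.IsSmooth (φ N)) ∧ (∀ N y, 0 ≤ φ N y) ∧ (∀ N, ∫ y, φ N y = 1) ∧ (∀ (N : ℕ) y, ((N : ℝ) + 1) ^ (-γ) ≤ Torus.euclidDist y 0 → φ N y = 0) ∧ (∀ (N : ℕ) y, φ N y ≤ C * ((N : ℝ) + 1) ^ (3 * γ)) ∧ (∀ (N : ℕ) y, ‖Literature.Analysis.FunctionSpaces.Torus.gradient (φ N) y‖ ≤ C * ((N : ℝ) + 1) ^ (4 * γ))) → ∃ m : ℝ, 0 < m ∧ ∃ N₀ : ℕ, ∀ N : ℕ, N₀ ≤ N → ∀ s ∈ Icc 0 t, ∀ x : T3, m ≤ ∫ z, empiricalDensityField ((Φ N).flow s z) (fun y => φ N (y - x)) ∂(localGibbsLaw σ (fun _ => a) (fun _ => uc) (fun _ => θc) N (Φ N)) := by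
  intro a θc uc ha hθc
  refine ⟨1 / 2, one_half_pos, 1, one_pos, ?_⟩
  intro σ _ hσlt _ _ _ _ _ Φ _ t _ _ _ γ C φ _ _ hadm
  refine ⟨1, one_pos, 0, fun N _ s _ x => ?_⟩
  haveI : IsProbabilityMeasure (localGibbsLaw σ (fun _ => a) (fun _ => uc) (fun _ => θc) N (Φ N)) :=
    isProbabilityMeasure_localGibbsLaw continuous_const continuous_const continuous_const
      (fun _ => ha) (fun _ => hθc) hσlt.le N (Φ N)
  rw [integral_blockDensity_flow_localGibbsLaw_const a θc uc Φ (hadm.1 N).continuous s x, hadm.2.2.1 N]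

end Summit.AtomisticToContinuum.HydrodynamicLimit.Theorems.MesoChebyshevWindow

end
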